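import Literature.Computability.AlgebraicComplexity.SmallFormatMatMulRankUpper
import Summits.MatrixMultiplication.OmegaCensus.SmallFormats.FlipComponent234GF2Data
import HarnessLib

/-!
# ω-census family (a4): the `𝔽₂` flip component of the Hopcroft–Kerr `⟨2,3,4⟩:20` scheme — definitions and kernel checks

Cell `pub-omega` (HOME `run/shared/lean/pub/pub-omega/`, unit `pub-omega-eng2`, ENG2 gen 4), topic
`Summits/MatrixMultiplication/OmegaCensus`.  Framing (verbatim): lottery ticket; floor = certified bounds/negative ranges.
HONEST FRAMING: computable definitions (packed `𝔽₂` rank-one terms, Kauers–Moosbauer flips, reducible nodes) and the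
chunked `decide +kernel` checks of the certificates in `FlipComponent234GF2Data.lean`; the STATEMENTS (component = the 441
schemes, none reducible) are assembled in `FlipComponent234GF2Component.lean`, whose module docstring explains the graph and
the census context (row R164).  A finite local fact about one flip graph; NOT a lower bound on any rank; no progress on `ω`.

Conventions: a term is `p = u + 64·v + 262144·w` (`u < 2^6` the `A`-mask, bit `μ + 3r`; `v < 2^12` the `B`-mask, bit
`s + 4μ`; `w < 2^8` the `C`-mask, bit `s + 4r` — slot conventions of `SmallFormatMatMulRankUpper.Scheme234`); a scheme is the
sorted list of its `20` packed terms.  References: Kauers–Moosbauer, arXiv:2212.01175 §3 [KauersMoosbauer2022FlipGraphs];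
Hopcroft–Kerr 1971 [HopcroftKerr1971]; catalogue entry `⟨2×3×4:20⟩` [SedoglavicFMMCatalogue].
-/

namespace Summit.MatrixMultiplication.OmegaCensus.FlipComponent234GF2

open Literature.Computability.AlgebraicComplexity

/-! ### Packed rank-one terms over `𝔽₂` -/

/-- The `A`-support mask (`6` bits) of a packed term. -/
def cU (p : ℕ) : ℕ := p % 64

/-- The `B`-support mask (`12` bits) of a packed term. -/
def cV (p : ℕ) : ℕ := p / 64 % 4096

/-- The `C`-support mask (`8` bits) of a packed term. -/
def cW (p : ℕ) : ℕ := p / 262144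

/-- Component `P ∈ {0,1,2}` (`u`, `v`, `w`) of a packed term. -/
def comp (p P : ℕ) : ℕ := if P = 0 then cU p else if P = 1 then cV p else cW p

/-- Pack three masks into one natural number. -/
def pack (u v w : ℕ) : ℕ := u + 64 * v + 262144 * w

/-- Replace component `P` of a packed term by `x`. -/
def setc (p P x : ℕ) : ℕ :=
  if P = 0 then pack x (cV p) (cW p) else if P = 1 then pack (cU p) x (cW p) else pack (cU p) (cV p) x

/-- Insert into a sorted list of naturals. -/
def ins (a : ℕ) : List ℕ → List ℕ
  | [] => [a]
  | b :: l => if a ≤ b then a :: b :: l else b :: ins a l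

/-- Insertion sort: the canonical form of a scheme is its sorted list of packed terms. -/
def isort : List ℕ → List ℕ
  | [] => []
  | a :: l => ins a (isort l)

/-! ### Flips -/

/-- The (at most two) flips on the pair of term indices `(i, j)` sharing position `P` with a nonzero common factor; `Q`, `R`
are the two other positions in index order.  Role `(a,b) = (i,j)`: term `i` gets `Q_i ⊕ Q_j`, term `j` gets `R_j ⊕ R_i`;
role `(a,b) = (j,i)` symmetrically.  Results in canonical (sorted) form. -/
def flipPair (s : List ℕ) (i j P Q R : ℕ) : List (List ℕ) :=
  let ti := s.getD i 0
  let tj := s.getD j 0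
  if comp ti P = comp tj P ∧ comp ti P ≠ 0 then
    [isort ((s.set i (setc ti Q (Nat.xor (comp ti Q) (comp tj Q)))).set j (setc tj R (Nat.xor (comp tj R) (comp ti R)))),
     isort ((s.set j (setc tj Q (Nat.xor (comp tj Q) (comp ti Q)))).set i (setc ti R (Nat.xor (comp ti R) (comp tj R))))]
  else []

/-- All flips on the pair `(i, j)`: shared position `P = 0, 1, 2` in this order. -/
def flipsIJ (s : List ℕ) (i j : ℕ) : List (List ℕ) :=
  flipPair s i j 0 1 2 ++ flipPair s i j 1 0 2 ++ flipPair s i j 2 0 1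

/-- Inner loop over `j` (only `i < j` contributes). -/
def flipsJ (s : List ℕ) (i : ℕ) : List ℕ → List (List ℕ)
  | [] => []
  | j :: js => (if i < j then flipsIJ s i j else []) ++ flipsJ s i js

/-- Outer loop over `i`. -/
def flipsI (s : List ℕ) : List ℕ → List (List ℕ)
  | [] => []
  | i :: is => flipsJ s i (List.range 20) ++ flipsI s is

/-- All flip neighbours (canonical forms, with multiplicity) of a `20`-term scheme, enumerated by `i < j < 20`, then
`P = 0,1,2`, then the two roles. -/
def flipsP (s : List ℕ) : List (List ℕ) := flipsI s (List.range 20)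

/-! ### Reducible (`r − 1`) nodes -/

/-- A term with an empty factor (its rank-one tensor is zero: droppable). -/
def zeroFactor (p : ℕ) : Bool := (cU p == 0) || (cV p == 0) || (cW p == 0)

/-- Two terms agreeing in two of the three positions (mergeable into one term). -/
def sharesTwo (p q : ℕ) : Bool :=
  (cU p == cU q && cV p == cV q) || (cU p == cU q && cW p == cW q) || (cV p == cV q && cW p == cW q)

/-- Some pair of terms of the list is mergeable. -/
def pairShares : List ℕ → Bool
  | [] => false
  | p :: l => l.any (sharesTwo p) || pairShares l

/-- A scheme is REDUCIBLE (an `r−1` node of the flip graph) iff it has a droppable term or a mergeable pair. -/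
def reducibleB (s : List ℕ) : Bool := s.any zeroFactor || pairShares s

/-! ### The start vertex: the Hopcroft–Kerr scheme reduced mod 2, computed from the tree-held tables -/

/-- Bitmask of an integer row mod `2`: bit `i` is set iff entry `i` is odd. -/
def maskRow : List ℤ → ℕ
  | [] => 0
  | x :: l => (if x % 2 = 0 then 0 else 1) + 2 * maskRow l

/-- Pack three parallel tables (rows = terms) into packed `𝔽₂` terms. -/
def zip3pack : List (List ℤ) → List (List ℤ) → List (List ℤ) → List ℕ
  | a :: as, b :: bs, c :: cs => pack (maskRow a) (maskRow b) (maskRow c) :: zip3pack as bs cs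
  | _, _, _ => []

/-- The Hopcroft–Kerr `⟨2,3,4⟩:20` scheme over `𝔽₂` in canonical form: `u` = slot-2 table (`A`), `v` = slot-3 table (`B`),
`w` = slot-1 table (`C`) of `SmallFormatMatMulRankUpper.Scheme234`, each reduced mod `2`. -/
def X : List ℕ := isort (zip3pack Scheme234.c2 Scheme234.c3 Scheme234.c1)

/-- Index of `X` in the data list `L`. -/
def xIdx : ℕ := 21

/-! ### List access helpers with their membership lemmas -/

/-- `j`-th element of a list of schemes (`[]` out of range). -/
def nth : List (List ℕ) → ℕ → List ℕ
  | [], _ => []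
  | a :: _, 0 => a
  | _ :: l, j + 1 => nth l j

/-- `j`-th element of a list of naturals (`0` out of range). -/
def nthN : List ℕ → ℕ → ℕ
  | [], _ => 0
  | a :: _, 0 => a
  | _ :: l, j + 1 => nthN l j

/-- In-range elements are members. -/
theorem nth_mem : ∀ (l : List (List ℕ)) (j : ℕ), j < l.length → nth l j ∈ l
  | [], _, h => absurd h (by simp)
  | a :: l, 0, _ => by simp [nth]
  | a :: l, j + 1, h => by
    simp only [List.length_cons] at h
    exact List.mem_cons_of_mem a (nth_mem l j (by omega))

/-- Members have an in-range index. -/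
theorem exists_nth_of_mem : ∀ (l : List (List ℕ)) (t : List ℕ), t ∈ l → ∃ j, j < l.length ∧ nth l j = t
  | [], t, h => absurd h (by simp)
  | a :: l, t, h => by
    rcases List.mem_cons.mp h with rfl | h'
    · exact ⟨0, by simp, rfl⟩
    · obtain ⟨j, hj, hjt⟩ := exists_nth_of_mem l t h'
      exact ⟨j + 1, by simp only [List.length_cons]; omega, by simpa [nth] using hjt⟩

/-! ### The kernel checks -/

set_option maxHeartbeats 4000000 in
/-- The data list has `441` entries. -/
theorem L_length : L.length = 441 := by decide +kernel

/-- Boolean duplicate-freeness test. -/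
def nodupB : List (List ℕ) → Bool
  | [] => true
  | a :: l => !(l.contains a) && nodupB l

/-- `nodupB` is sound. -/
theorem nodup_of_nodupB : ∀ l : List (List ℕ), nodupB l = true → l.Nodup
  | [], _ => List.nodup_nil
  | a :: l, h => by
    simp only [nodupB, Bool.and_eq_true, Bool.not_eq_true'] at h
    obtain ⟨ha, hl⟩ := h
    refine List.nodup_cons.mpr ⟨fun hm => ?_, nodup_of_nodupB l hl⟩
    rw [List.contains_iff_mem.mpr hm] at ha
    exact Bool.noConfusion ha

set_option maxHeartbeats 4000000 in
set_option maxRecDepth 100000 in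
/-- KERNEL CHECK: no duplicates in `L`. -/
theorem nodup_check : nodupB L = true := by decide +kernel

/-- The `441` schemes are pairwise distinct. -/
theorem L_nodup : L.Nodup := nodup_of_nodupB L nodup_check

set_option maxHeartbeats 4000000 in
/-- `X` is entry `xIdx = 21` of `L`. -/
theorem nth_xIdx : nth L xIdx = X := by decide +kernel

/-- One row of the closure certificate: all indices in range and the flip neighbours of `s` are exactly the listed entries of `L`. -/
def rowOK (s : List ℕ) (js : List ℕ) : Bool :=
  js.all (fun j => decide (j < 441)) && (flipsP s == js.map (nth L))

/-- Row `k` of the closure certificate. -/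
def rowK (k : ℕ) : Bool := rowOK (nth L k) (nth cert k)

/-- The interval `[a, a + n)` as a list (structural, for chunked kernel checks). -/
def iota (a : ℕ) : ℕ → List ℕ
  | 0 => []
  | n + 1 => a :: iota (a + 1) n

/-- Membership in `iota`. -/
theorem mem_iota : ∀ (n a k : ℕ), a ≤ k → k < a + n → k ∈ iota a n
  | 0, _, _, h1, h2 => absurd h2 (by omega)
  | n + 1, a, k, h1, h2 => by
    by_cases hk : k = a
    · subst hk; simp [iota]
    · exact List.mem_cons_of_mem a (mem_iota n (a + 1) k (by omega) (by omega))

/-- From a chunked `all` to a pointwise statement. -/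
theorem of_all_iota {f : ℕ → Bool} {a n : ℕ} (h : (iota a n).all f = true) (k : ℕ) (h1 : a ≤ k) (h2 : k < a + n) :
    f k = true :=
  List.all_eq_true.mp h k (mem_iota n a k h1 h2)

set_option maxHeartbeats 40000000 in
/-- KERNEL CHECK (closure), rows `0 … 48`. -/
theorem closed_c0 : (iota 0 49).all rowK = true := by decide +kernel

set_option maxHeartbeats 40000000 in
/-- KERNEL CHECK (closure), rows `49 … 97`. -/
theorem closed_c1 : (iota 49 49).all rowK = true := by decide +kernel

set_option maxHeartbeats 40000000 in
/-- KERNEL CHECK (closure), rows `98 … 146`. -/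
theorem closed_c2 : (iota 98 49).all rowK = true := by decide +kernel

set_option maxHeartbeats 40000000 in
/-- KERNEL CHECK (closure), rows `147 … 195`. -/
theorem closed_c3 : (iota 147 49).all rowK = true := by decide +kernel

set_option maxHeartbeats 40000000 in
/-- KERNEL CHECK (closure), rows `196 … 244`. -/
theorem closed_c4 : (iota 196 49).all rowK = true := by decide +kernel

set_option maxHeartbeats 40000000 in
/-- KERNEL CHECK (closure), rows `245 … 293`. -/
theorem closed_c5 : (iota 245 49).all rowK = true := by decide +kernel

set_option maxHeartbeats 40000000 in
/-- KERNEL CHECK (closure), rows `294 … 342`. -/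
theorem closed_c6 : (iota 294 49).all rowK = true := by decide +kernel

set_option maxHeartbeats 40000000 in
/-- KERNEL CHECK (closure), rows `343 … 391`. -/
theorem closed_c7 : (iota 343 49).all rowK = true := by decide +kernel

set_option maxHeartbeats 40000000 in
/-- KERNEL CHECK (closure), rows `392 … 440`. -/
theorem closed_c8 : (iota 392 49).all rowK = true := by decide +kernel

/-- Closure certificate, all rows. -/
theorem rowK_all (k : ℕ) (hk : k < 441) : rowK k = true := by
  by_cases h0 : k < 49
  · exact of_all_iota closed_c0 k (by omega) (by omega)
  by_cases h1 : k < 98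
  · exact of_all_iota closed_c1 k (by omega) (by omega)
  by_cases h2 : k < 147
  · exact of_all_iota closed_c2 k (by omega) (by omega)
  by_cases h3 : k < 196
  · exact of_all_iota closed_c3 k (by omega) (by omega)
  by_cases h4 : k < 245
  · exact of_all_iota closed_c4 k (by omega) (by omega)
  by_cases h5 : k < 294
  · exact of_all_iota closed_c5 k (by omega) (by omega)
  by_cases h6 : k < 343
  · exact of_all_iota closed_c6 k (by omega) (by omega)
  by_cases h7 : k < 392
  · exact of_all_iota closed_c7 k (by omega) (by omega)
  exact of_all_iota closed_c8 k (by omega) (by omega)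

set_option maxHeartbeats 40000000 in
set_option maxRecDepth 100000 in
/-- KERNEL CHECK (irreducibility): no scheme of `L` is reducible. -/
theorem irreducible_check : L.all (fun s => !reducibleB s) = true := by decide +kernel

/-- One row of the exhaustion certificate: the root is `X` at depth `0`; every other scheme is a flip neighbour of its BFS
parent, one level up. -/
def parentOK (k : ℕ) : Bool :=
  if k = xIdx then (nthN depth k == 0) && (nth L k == X)
  else decide (nthN parent k < 441) && (nthN depth k == nthN depth (nthN parent k) + 1) &&
    (flipsP (nth L (nthN parent k))).contains (nth L k)

set_option maxHeartbeats 40000000 in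
/-- KERNEL CHECK (exhaustion), rows `0 … 48`. -/
theorem parents_c0 : (iota 0 49).all parentOK = true := by decide +kernel

set_option maxHeartbeats 40000000 in
/-- KERNEL CHECK (exhaustion), rows `49 … 97`. -/
theorem parents_c1 : (iota 49 49).all parentOK = true := by decide +kernel

set_option maxHeartbeats 40000000 in
/-- KERNEL CHECK (exhaustion), rows `98 … 146`. -/
theorem parents_c2 : (iota 98 49).all parentOK = true := by decide +kernel

set_option maxHeartbeats 40000000 in
/-- KERNEL CHECK (exhaustion), rows `147 … 195`. -/
theorem parents_c3 : (iota 147 49).all parentOK = true := by decide +kernel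

set_option maxHeartbeats 40000000 in
/-- KERNEL CHECK (exhaustion), rows `196 … 244`. -/
theorem parents_c4 : (iota 196 49).all parentOK = true := by decide +kernel

set_option maxHeartbeats 40000000 in
/-- KERNEL CHECK (exhaustion), rows `245 … 293`. -/
theorem parents_c5 : (iota 245 49).all parentOK = true := by decide +kernel

set_option maxHeartbeats 40000000 in
/-- KERNEL CHECK (exhaustion), rows `294 … 342`. -/
theorem parents_c6 : (iota 294 49).all parentOK = true := by decide +kernel

set_option maxHeartbeats 40000000 in
/-- KERNEL CHECK (exhaustion), rows `343 … 391`. -/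
theorem parents_c7 : (iota 343 49).all parentOK = true := by decide +kernel

set_option maxHeartbeats 40000000 in
/-- KERNEL CHECK (exhaustion), rows `392 … 440`. -/
theorem parents_c8 : (iota 392 49).all parentOK = true := by decide +kernel

/-- Exhaustion certificate, all rows. -/
theorem parentOK_of_lt {k : ℕ} (hk : k < 441) : parentOK k = true := by
  by_cases h0 : k < 49
  · exact of_all_iota parents_c0 k (by omega) (by omega)
  by_cases h1 : k < 98
  · exact of_all_iota parents_c1 k (by omega) (by omega)
  by_cases h2 : k < 147
  · exact of_all_iota parents_c2 k (by omega) (by omega)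
  by_cases h3 : k < 196
  · exact of_all_iota parents_c3 k (by omega) (by omega)
  by_cases h4 : k < 245
  · exact of_all_iota parents_c4 k (by omega) (by omega)
  by_cases h5 : k < 294
  · exact of_all_iota parents_c5 k (by omega) (by omega)
  by_cases h6 : k < 343
  · exact of_all_iota parents_c6 k (by omega) (by omega)
  by_cases h7 : k < 392
  · exact of_all_iota parents_c7 k (by omega) (by omega)
  exact of_all_iota parents_c8 k (by omega) (by omega)

end Summit.MatrixMultiplication.OmegaCensus.FlipComponent234GF2
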